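import Summits.RiemannHypothesis.RiemannHypothesis.Theorems.WeilFormatCCinfReindex
import HarnessLib

/-!
# Format C, design C∞ (E3, analytic side): truncation of a collected object with ℕ-INDEXED coefficients

Route context: Fourier–Galerkin / Schur-complement certificates of Weil positivity on a window ("format C", C∞ door;
cell memo `run/shared/lean/pub/rh-explicit/rh-explicit-weil-10/KERNEL-LEVER.md` §22; supporting stmt-RiemannHypothesis-0098;
seat rh-explicit-weil-10).  `collected_truncate_short` (`WeilFormatCCinfReindex`) cuts a collected object at power `E₀` and
re-indexes it to `Fin 4 × Fin (E₀+1)` with coefficients `A(y.1, castLE y.2)`.  The printed fiber sums of the C∞ door are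
functions `P : Fin 4 → ℕ → ℝ` of (tag, power) applied to `(x.1, ↑x.2)`; for them the cut is simply the SAME `P` over the
shorter index — which is the shape weil-2's `cinf_collected_rescale` consumes (`P y.1 ↑y.2`), so truncation and rescaling
chain with no bookkeeping:

* `collected_truncate_nat` — `|X − ε Σ_{x : Fin 4 × Fin (D+1)} P(x.1,x.2)·T_{x.1}/m^{x.2}| ≤ ρ(m₀/m)^{E+1}` ⟹
  `|X − ε Σ_{y : Fin 4 × Fin (E₀+1)} P(y.1,y.2)·T_{y.1}/m^{y.2}| ≤ (ρ + Σ_{x, x.2 > E₀} |P(x.1,x.2)|·τ_{x.1}/m₀^{x.2})(m₀/m)^{E+1}`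
  for `E + 1 ≤ E₀ ≤ D`, `|ε| ≤ 1`, `1 ≤ m₀ ≤ m`;
* `truncation_tail_nonneg` — the added remainder is `≥ 0`.

Elementary; standard axioms; no definitions; no RH claim.
-/

set_option autoImplicit false
-- `Summit.RiemannHypothesis.RiemannHypothesis.…` is the layout-mandated namespace (summit = problem name).
set_option linter.dupNamespace false

noncomputable section

open Finset
open scoped BigOperators Real ArithmeticFunction.vonMangoldt

namespace Summit.RiemannHypothesis.RiemannHypothesis.Theorems.WeilFormatC

open Literature.NumberTheory.LFunctions

variable {a : ℝ}

/-- **Truncation at power `E₀`, ℕ-indexed coefficients.**  See the module docstring. -/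
theorem collected_truncate_nat {X ε ρ : ℝ} {m₀ m : ℕ} (hm₀ : 1 ≤ m₀) (hm : m₀ ≤ m) {D E E₀ : ℕ}
    (hE : E + 1 ≤ E₀) (hED : E₀ ≤ D) (hε : |ε| ≤ 1) (P : Fin 4 → ℕ → ℝ)
    (h : |X - ε * ∑ x : Fin 4 × Fin (D + 1), P x.1 x.2 *
        (![(1 : ℝ), Real.log m, -(∑ n ∈ weilPrimeIndex a, (Λ n : ℝ) / Real.sqrt n * Real.cos (π * m / a * Real.log n)),
          (∑ n ∈ weilPrimeIndex a, (Λ n : ℝ) / Real.sqrt n * Real.sin (π * m / a * Real.log n))] x.1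
          / (m : ℝ) ^ (x.2 : ℕ))| ≤ ρ * ((m₀ : ℝ) / m) ^ (E + 1)) :
    |X - ε * ∑ y : Fin 4 × Fin (E₀ + 1), P y.1 y.2 *
        (![(1 : ℝ), Real.log m, -(∑ n ∈ weilPrimeIndex a, (Λ n : ℝ) / Real.sqrt n * Real.cos (π * m / a * Real.log n)),
          (∑ n ∈ weilPrimeIndex a, (Λ n : ℝ) / Real.sqrt n * Real.sin (π * m / a * Real.log n))] y.1
          / (m : ℝ) ^ (y.2 : ℕ))|
      ≤ (ρ + ∑ x : Fin 4 × Fin (D + 1), if E₀ < (x.2 : ℕ) then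
          |P x.1 x.2| * (![(1 : ℝ), (m₀ : ℝ), ∑ n ∈ weilPrimeIndex a, (Λ n : ℝ) / Real.sqrt n,
            ∑ n ∈ weilPrimeIndex a, (Λ n : ℝ) / Real.sqrt n] x.1) / (m₀ : ℝ) ^ (x.2 : ℕ) else 0)
        * ((m₀ : ℝ) / m) ^ (E + 1) := by
  have ht := collected_truncate (a := a) hm₀ hm hE hε (fun x : Fin 4 × Fin (D + 1) ↦ P x.1 x.2) h
  rw [sum_trunc_eq_sum_castLE hED (fun x : Fin 4 × Fin (D + 1) ↦ P x.1 x.2) (fun t d ↦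
      (![(1 : ℝ), Real.log m, -(∑ n ∈ weilPrimeIndex a, (Λ n : ℝ) / Real.sqrt n * Real.cos (π * m / a * Real.log n)),
        (∑ n ∈ weilPrimeIndex a, (Λ n : ℝ) / Real.sqrt n * Real.sin (π * m / a * Real.log n))] t) / (m : ℝ) ^ d)] at ht
  simp only [Fin.val_castLE] at ht
  exact ht

/-- The truncation remainder is nonnegative. -/
theorem truncation_tail_nonneg (a : ℝ) (m₀ : ℕ) {D : ℕ} (E₀ : ℕ) (P : Fin 4 → ℕ → ℝ) :
    0 ≤ ∑ x : Fin 4 × Fin (D + 1), if E₀ < (x.2 : ℕ) then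
          |P x.1 x.2| * (![(1 : ℝ), (m₀ : ℝ), ∑ n ∈ weilPrimeIndex a, (Λ n : ℝ) / Real.sqrt n,
            ∑ n ∈ weilPrimeIndex a, (Λ n : ℝ) / Real.sqrt n] x.1) / (m₀ : ℝ) ^ (x.2 : ℕ) else 0 := by
  refine Finset.sum_nonneg fun x _ ↦ ?_
  split_ifs
  · have hL : 0 ≤ ∑ n ∈ weilPrimeIndex a, (Λ n : ℝ) / Real.sqrt n :=
      Finset.sum_nonneg fun n _ ↦ div_nonneg ArithmeticFunction.vonMangoldt_nonneg (Real.sqrt_nonneg _)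
    have hτ : 0 ≤ (![(1 : ℝ), (m₀ : ℝ), ∑ n ∈ weilPrimeIndex a, (Λ n : ℝ) / Real.sqrt n,
        ∑ n ∈ weilPrimeIndex a, (Λ n : ℝ) / Real.sqrt n] x.1) := by
      rcases x with ⟨t, d⟩
      fin_cases t <;> simp [hL]
    positivity
  · exact le_rfl

end Summit.RiemannHypothesis.RiemannHypothesis.Theorems.WeilFormatC

end
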